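import Summits.HodgeConjecture.CorCM.Census.QuaternionColumnBiarc

/-!
# The quaternion column, IV: the potential of a biarc — `bpot (barc p q) = min (Δ(p,q), n − Δ(p,q))`

COR-CM (cell `pub-hodgecm2`), count-neutral kernel combinatorics by the binder seat b09 (gen 39; lane QUATERNION COLUMN), part IV, on part I
`Census/QuaternionColumnBiarc.lean` (`barc`, `rt_a_barc`, `rt_xa_barc`) and part C `Census/BaseBlockCovering.lean` (`bpot`, `bpot_le`,
`exists_bpot_eq`) used BY NAME.  One bookkeeping definition with body (`arcZ`, the arc `{x, …, x+n−1} ⊆ ℤ/2n`) + theorems; no `decide`, no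
certificate, no named fact, no `sorry`.  HONEST FRAMING: `HC_CM` is NOT proved, here or anywhere in the tree; nothing here is a period.

WHY.  The explicit covering faces of the quaternion column (the biarc faces covering the far biarc blocks) must be `toward a nearest base
change` (`BaseBlock.toward_of_explicit`); this needs the EXACT potential of a biarc with respect to the base block of `T₀ = barc 0 0`.

CONTENT.
* §1 **Arcs** `arcZ x = {i : (i − x).val < n}`: `|arcZ x| = n` (`card_arcZ`), the antipodal arc is the complement (`arcZ_add_n`), and the
  **arc distance** `Δ(x,y) = |arcZ x ∖ arcZ y|`: symmetric (`delta_comm`), a metric (`delta_triangle`), `Δ(x+n, y) + Δ(x, y) = n`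
  (`delta_add_n`), and `Δ(x, x+d) = Δ(x+d, x) = d` for `d ≤ n` (`delta_self_add`, `delta_add_self`).
* §2 **Deviation distance of biarcs** = sum of the arc distances of their halves (`ddist_barc_barc`).
* §3 **The base changes of `T₀`** are `barc p p` and `barc p (p+n)` (`rt_base_cases`), so **`bpot (barc p q) = min (Δ(p,q), n − Δ(p,q))`**
  (`bpot_barc`: `≤` by the two witnesses `barc p p = T₀·(a (−p))⁻¹`, `barc p (p+n)`; `≥` by the triangle inequality).

## References
* [Pohlmann1968] H. Pohlmann, Algebraic cycles on abelian varieties of complex multiplication type, Ann. of Math. 88 (1968), Thm 1.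
-/

namespace Summit.HodgeConjecture.CorCM.Census.QuaternionColumn

open Finset QuaternionGroup
open Summit.HodgeConjecture.CorCM.Prior.AllgGroup.RfwfAllgGroup
open Summit.HodgeConjecture.CorCM.Census.BlockParity
open Summit.HodgeConjecture.CorCM.Census.BaseBlock
open Summit.HodgeConjecture.CorCM.Census.TwistGeneration

noncomputable section

variable {n : ℕ} [NeZero n]

/-! ## §1 Arcs of `ℤ/2n` and the arc distance -/

/-- **The arc** `arcZ x = {x, x+1, …, x+n−1} ⊆ ℤ/2n`. [folklore] -/
def arcZ (x : ZMod (2 * n)) : Finset (ZMod (2 * n)) := univ.filter fun i => (i - x).val < n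

/-- Membership in an arc. [folklore] -/
@[simp] theorem mem_arcZ (x i : ZMod (2 * n)) : i ∈ arcZ x ↔ (i - x).val < n := by simp [arcZ]

/-- **An arc is the translate of `{0, …, n−1}`**: `arcZ x = {x + t : t < n}`. [folklore] -/
theorem arcZ_eq_image (x : ZMod (2 * n)) : arcZ x = (range n).image fun t : ℕ => x + (t : ZMod (2 * n)) := by
  have hn := NeZero.ne n
  ext i
  rw [mem_arcZ, mem_image]
  constructor
  · intro h
    refine ⟨(i - x).val, mem_range.mpr h, ?_⟩
    rw [ZMod.natCast_zmod_val, add_sub_cancel]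
  · rintro ⟨t, ht, rfl⟩
    rw [mem_range] at ht
    rw [add_sub_cancel_left, ZMod.val_cast_of_lt (by omega)]
    exact ht

omit [NeZero n] in
/-- Translates of an initial segment of `ℕ` of length `≤ 2n` are injective. [folklore] -/
theorem injOn_add_natCast (x : ZMod (2 * n)) {d : ℕ} (hd : d ≤ 2 * n) :
    Set.InjOn (fun t : ℕ => x + (t : ZMod (2 * n))) ↑(range d) := by
  intro t ht t' ht' h
  have ht : t < d := mem_range.mp (mem_coe.mp ht)
  have ht' : t' < d := mem_range.mp (mem_coe.mp ht')
  have h' : ((t : ℕ) : ZMod (2 * n)) = (t' : ℕ) := add_left_cancel h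
  have h'' := congrArg ZMod.val h'
  rwa [ZMod.val_cast_of_lt (by omega), ZMod.val_cast_of_lt (by omega)] at h''

/-- **`|arcZ x| = n`.** [folklore] -/
theorem card_arcZ (x : ZMod (2 * n)) : (arcZ x).card = n := by
  rw [arcZ_eq_image, card_image_of_injOn (injOn_add_natCast x (by omega)), card_range]

/-- **The antipodal arc is the complement**: `arcZ (x + n) = univ ∖ arcZ x`. [folklore] -/
theorem arcZ_add_n (x : ZMod (2 * n)) : arcZ (x + (n : ZMod (2 * n))) = univ \ arcZ x := by
  ext i
  rw [mem_sdiff, mem_arcZ, mem_arcZ, show i - (x + (n : ZMod (2 * n))) = (i - x) - n by ring, sub_n_eq_add_n]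
  have h := lt_iff_not_lt_add_n (i - x)
  simp only [mem_univ, true_and]
  tauto

/-- `Δ(x, x) = 0`. [folklore] -/
theorem delta_self (x : ZMod (2 * n)) : (arcZ x \ arcZ x).card = 0 := by rw [sdiff_self, bot_eq_empty, card_empty]

/-- **The arc distance is symmetric**: `|arcZ x ∖ arcZ y| = |arcZ y ∖ arcZ x|` (both arcs have `n` elements). [folklore] -/
theorem delta_comm (x y : ZMod (2 * n)) : (arcZ x \ arcZ y).card = (arcZ y \ arcZ x).card := by
  have h1 := card_sdiff_add_card_inter (arcZ x) (arcZ y)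
  have h2 := card_sdiff_add_card_inter (arcZ y) (arcZ x)
  rw [card_arcZ] at h1 h2
  rw [inter_comm] at h2
  omega

/-- **Triangle inequality** for the arc distance. [folklore] -/
theorem delta_triangle (x y z : ZMod (2 * n)) : (arcZ x \ arcZ z).card ≤ (arcZ x \ arcZ y).card + (arcZ y \ arcZ z).card := by
  calc (arcZ x \ arcZ z).card ≤ ((arcZ x \ arcZ y) ∪ (arcZ y \ arcZ z)).card := by
        refine card_le_card fun i hi => ?_
        rw [mem_sdiff] at hi
        by_cases h : i ∈ arcZ y
        · exact mem_union_right _ (mem_sdiff.mpr ⟨h, hi.2⟩)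
        · exact mem_union_left _ (mem_sdiff.mpr ⟨hi.1, h⟩)
    _ ≤ _ := card_union_le _ _

/-- **Antipodal arc distance**: `Δ(x+n, y) + Δ(x, y) = n`. [folklore] -/
theorem delta_add_n (x y : ZMod (2 * n)) :
    (arcZ (x + (n : ZMod (2 * n))) \ arcZ y).card + (arcZ x \ arcZ y).card = n := by
  have h1 : (arcZ (x + (n : ZMod (2 * n))) \ arcZ y).card = 2 * n - (arcZ x ∪ arcZ y).card := by
    rw [arcZ_add_n, sdiff_sdiff_left, ← sup_eq_union, card_univ_sdiff, ZMod.card]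
  have h2 : (arcZ x \ arcZ y).card + (arcZ y).card = (arcZ x ∪ arcZ y).card := card_sdiff_add_card (arcZ x) (arcZ y)
  have h3 : (arcZ x ∪ arcZ y).card ≤ 2 * n := by
    have h := card_le_univ (arcZ x ∪ arcZ y); rwa [ZMod.card] at h
  rw [card_arcZ] at h2
  omega

/-- **`Δ(x, x + d) = d`** for `d ≤ n`: `arcZ x ∖ arcZ (x+d) = {x, …, x+d−1}`. [folklore] -/
theorem delta_self_add (x : ZMod (2 * n)) {d : ℕ} (hd : d ≤ n) :
    (arcZ x \ arcZ (x + (d : ZMod (2 * n)))).card = d := by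
  have hn := NeZero.ne n
  have hdval : ((d : ℕ) : ZMod (2 * n)).val = d := ZMod.val_cast_of_lt (by omega)
  have himg : arcZ x \ arcZ (x + (d : ZMod (2 * n))) = (range d).image fun t : ℕ => x + (t : ZMod (2 * n)) := by
    ext i
    rw [mem_sdiff, mem_arcZ, mem_arcZ, mem_image, show i - (x + (d : ZMod (2 * n))) = (i - x) - d by ring,
      val_sub_eq (i - x) ((d : ℕ) : ZMod (2 * n)), hdval]
    constructor
    · rintro ⟨h1, h2⟩
      have h3 : (i - x).val < d := by
        by_contra h4
        rw [if_pos (by omega)] at h2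
        omega
      refine ⟨(i - x).val, mem_range.mpr h3, ?_⟩
      rw [ZMod.natCast_zmod_val, add_sub_cancel]
    · rintro ⟨t, ht, rfl⟩
      rw [mem_range] at ht
      rw [add_sub_cancel_left, ZMod.val_cast_of_lt (by omega)]
      refine ⟨by omega, ?_⟩
      rw [if_neg (by omega)]
      omega
  rw [himg, card_image_of_injOn (injOn_add_natCast x (by omega)), card_range]

/-- **`Δ(x + d, x) = d`** for `d ≤ n`. [folklore] -/
theorem delta_add_self (x : ZMod (2 * n)) {d : ℕ} (hd : d ≤ n) :
    (arcZ (x + (d : ZMod (2 * n))) \ arcZ x).card = d := by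
  rw [delta_comm, delta_self_add x hd]

/-! ## §2 The deviation distance of two biarcs -/

/-- The rotations of a biarc form the arc `arcZ p`, the reflections the arc `arcZ q`. [folklore] -/
theorem barc_val_eq (p q : ZMod (2 * n)) :
    (barc p q).1 = (arcZ p).image (fun i => (a i : QuaternionGroup n)) ∪ (arcZ q).image (fun j => (xa j : QuaternionGroup n)) := by
  ext g
  rw [mem_union, mem_image, mem_image]
  cases g with
  | a i =>
    rw [a_mem_barc]
    constructor
    · intro h; exact Or.inl ⟨i, (mem_arcZ p i).mpr h, rfl⟩
    · rintro (⟨i', hi', h⟩ | ⟨j, -, h⟩)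
      · rw [QuaternionGroup.a.inj h] at hi'; exact (mem_arcZ p i).mp hi'
      · cases h
  | xa j =>
    rw [xa_mem_barc]
    constructor
    · intro h; exact Or.inr ⟨j, (mem_arcZ q j).mpr h, rfl⟩
    · rintro (⟨i, -, h⟩ | ⟨j', hj', h⟩)
      · cases h
      · rw [QuaternionGroup.xa.inj h] at hj'; exact (mem_arcZ q j).mp hj'

/-- **The deviation distance of two biarcs is the sum of the arc distances of their halves.** [folklore] -/
theorem ddist_barc_barc (p' q' p q : ZMod (2 * n)) :
    ddist (barc p' q') (barc p q) = (arcZ p' \ arcZ p).card + (arcZ q' \ arcZ q).card := by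
  unfold ddist
  have hsd : (barc p' q').1 \ (barc p q).1 =
      (arcZ p' \ arcZ p).image (fun i => (a i : QuaternionGroup n)) ∪ (arcZ q' \ arcZ q).image (fun j => (xa j : QuaternionGroup n)) := by
    ext g
    rw [mem_sdiff, mem_union, mem_image, mem_image]
    cases g with
    | a i =>
      rw [a_mem_barc, a_mem_barc]
      constructor
      · rintro ⟨h1, h2⟩
        exact Or.inl ⟨i, mem_sdiff.mpr ⟨(mem_arcZ _ _).mpr h1, fun h => h2 ((mem_arcZ _ _).mp h)⟩, rfl⟩
      · rintro (⟨i', hi', h⟩ | ⟨j, -, h⟩)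
        · rw [QuaternionGroup.a.inj h] at hi'
          rw [mem_sdiff, mem_arcZ, mem_arcZ] at hi'
          exact hi'
        · cases h
    | xa j =>
      rw [xa_mem_barc, xa_mem_barc]
      constructor
      · rintro ⟨h1, h2⟩
        exact Or.inr ⟨j, mem_sdiff.mpr ⟨(mem_arcZ _ _).mpr h1, fun h => h2 ((mem_arcZ _ _).mp h)⟩, rfl⟩
      · rintro (⟨i, -, h⟩ | ⟨j', hj', h⟩)
        · cases h
        · rw [QuaternionGroup.xa.inj h] at hj'
          rw [mem_sdiff, mem_arcZ, mem_arcZ] at hj'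
          exact hj'
  rw [hsd, card_union_of_disjoint, card_image_of_injective _ (fun _ _ h => QuaternionGroup.a.inj h),
    card_image_of_injective _ (fun _ _ h => QuaternionGroup.xa.inj h)]
  rw [disjoint_left]
  rintro g hg hg'
  obtain ⟨i, -, rfl⟩ := mem_image.mp hg
  obtain ⟨j, -, h⟩ := mem_image.mp hg'
  cases h

/-! ## §3 The base changes of `T₀ = barc 0 0` and the potential of a biarc -/

/-- **The base changes of `T₀`** are the diagonal biarcs `barc p p` and their half-turn partners `barc p (p + n)`. [folklore] -/
theorem rt_base_cases (Q : QuaternionGroup n) :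
    ∃ p : ZMod (2 * n), rt (c n) Q (barc 0 0) = barc p p ∨ rt (c n) Q (barc 0 0) = barc p (p + (n : ZMod (2 * n))) := by
  cases Q with
  | a k => exact ⟨0 - k, Or.inl (by rw [rt_a_barc])⟩
  | xa k =>
    refine ⟨k - 0 + (n : ZMod (2 * n)) + 1, Or.inr ?_⟩
    rw [rt_xa_barc]
    congr 1
    linear_combination (-1 : ZMod (2 * n)) * two_n_eq_zero (n := n)

/-- The diagonal biarc is a base change: `barc p p = T₀·(a (−p))⁻¹`. [folklore] -/
theorem barc_diag_eq_rt (p : ZMod (2 * n)) : barc p p = rt (c n) (a (-p)) (barc 0 0) := by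
  rw [rt_a_barc, zero_sub, neg_neg]

/-- … and so is its half-turn partner: `barc p (p + n) = T₀·(xa (p − n − 1))⁻¹`. [folklore] -/
theorem barc_diag_add_n_eq_rt (p : ZMod (2 * n)) :
    barc p (p + (n : ZMod (2 * n))) = rt (c n) (xa (p - (n : ZMod (2 * n)) - 1)) (barc 0 0) := by
  rw [rt_xa_barc]
  congr 1
  · ring
  · linear_combination two_n_eq_zero (n := n)

/-- Distance from the diagonal: `ddist (barc p p) (barc p q) = Δ(p, q)`. [folklore] -/
theorem ddist_diag (p q : ZMod (2 * n)) : ddist (barc p p) (barc p q) = (arcZ p \ arcZ q).card := by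
  rw [ddist_barc_barc, delta_self, zero_add]

/-- Distance from the half-turned diagonal: `ddist (barc p (p+n)) (barc p q) + Δ(p, q) = n`. [folklore] -/
theorem ddist_diag_add_n (p q : ZMod (2 * n)) :
    ddist (barc p (p + (n : ZMod (2 * n)))) (barc p q) + (arcZ p \ arcZ q).card = n := by
  rw [ddist_barc_barc, delta_self, zero_add, delta_add_n]

/-- **THE POTENTIAL OF A BIARC**: `bpot (barc p q) = min (Δ(p,q), n − Δ(p,q))` with respect to `T₀ = barc 0 0`. [folklore] -/
theorem bpot_barc (p q : ZMod (2 * n)) :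
    bpot (c n) (barc 0 0) (barc p q) = min (arcZ p \ arcZ q).card (n - (arcZ p \ arcZ q).card) := by
  apply le_antisymm
  · -- the two witnesses
    have h1 := bpot_le (c n) (barc 0 0) (barc p q) (a (-p))
    rw [← barc_diag_eq_rt, ddist_diag] at h1
    have h2 := bpot_le (c n) (barc 0 0) (barc p q) (xa (p - (n : ZMod (2 * n)) - 1))
    rw [← barc_diag_add_n_eq_rt] at h2
    have h3 := ddist_diag_add_n p q
    exact le_min h1 (by omega)
  · -- every base change is a diagonal or a half-turned diagonal; triangle inequality
    obtain ⟨Q, hQ⟩ := exists_bpot_eq (c n) (barc 0 0) (barc p q)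
    obtain ⟨p', hp' | hp'⟩ := rt_base_cases (n := n) Q
    · rw [hQ, hp', ddist_barc_barc]
      have ht := delta_triangle p p' q
      rw [delta_comm p p'] at ht
      exact (min_le_left _ _).trans ht
    · rw [hQ, hp', ddist_barc_barc]
      have ht := delta_triangle p' p q
      have ha := delta_add_n p' q
      have hle : (arcZ p \ arcZ q).card ≤ n := by
        have h := card_le_card (sdiff_subset : arcZ p \ arcZ q ⊆ arcZ p); rwa [card_arcZ] at h
      refine (min_le_right _ _).trans ?_
      omega

/-- **Near the diagonal the diagonal is nearest**: if `2Δ(p,q) ≤ n` then `bpot (barc p q) = ddist (barc p p) (barc p q) = Δ(p,q)`. [folklore] -/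
theorem bpot_barc_of_le (p q : ZMod (2 * n)) (h : 2 * (arcZ p \ arcZ q).card ≤ n) :
    bpot (c n) (barc 0 0) (barc p q) = (arcZ p \ arcZ q).card := by
  rw [bpot_barc]; exact min_eq_left (by omega)

/-- **Far from the diagonal the half-turned diagonal is nearest**: if `n ≤ 2Δ(p,q)` then `bpot (barc p q) + Δ(p,q) = n`. [folklore] -/
theorem bpot_barc_of_ge (p q : ZMod (2 * n)) (h : n ≤ 2 * (arcZ p \ arcZ q).card) :
    bpot (c n) (barc 0 0) (barc p q) + (arcZ p \ arcZ q).card = n := by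
  have hle : (arcZ p \ arcZ q).card ≤ n := by
    have h := card_le_card (sdiff_subset : arcZ p \ arcZ q ⊆ arcZ p); rwa [card_arcZ] at h
  rw [bpot_barc, min_eq_right (by omega)]
  omega

/-- The diagonal block is the base block: `bpot (barc p p) = 0` and `bpot (barc p (p+n)) = 0`. [folklore] -/
theorem bpot_diag (p : ZMod (2 * n)) :
    bpot (c n) (barc 0 0) (barc p p) = 0 ∧ bpot (c n) (barc 0 0) (barc p (p + (n : ZMod (2 * n)))) = 0 := by
  rw [barc_diag_eq_rt p, bpot_rt, barc_diag_add_n_eq_rt p, bpot_rt]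
  have h := bpot_le (c n) (barc (0 : ZMod (2 * n)) 0) (barc 0 0) 1
  rw [rt_one, ddist_self, Nat.le_zero] at h
  exact ⟨h, h⟩

/-- **The next-to-diagonal biarcs are residual**: `bpot (barc p (p+1)) ≤ 1`, `bpot (barc (p+1) p) ≤ 1`, and the same for their half-turn
partners `barc p (p+1+n)`, `barc (p+1) (p+n)`. [folklore] -/
theorem bpot_next_le_one (p : ZMod (2 * n)) :
    bpot (c n) (barc 0 0) (barc p (p + 1)) ≤ 1 ∧ bpot (c n) (barc 0 0) (barc (p + 1) p) ≤ 1 ∧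
      bpot (c n) (barc 0 0) (barc p (p + 1 + (n : ZMod (2 * n)))) ≤ 1 ∧
        bpot (c n) (barc 0 0) (barc (p + 1) (p + (n : ZMod (2 * n)))) ≤ 1 := by
  have hn : 1 ≤ n := Nat.one_le_iff_ne_zero.mpr (NeZero.ne n)
  have d1 : (arcZ p \ arcZ (p + 1)).card = 1 := by
    have h := delta_self_add p hn; rwa [Nat.cast_one] at h
  have d2 : (arcZ (p + 1) \ arcZ p).card = 1 := by
    have h := delta_add_self p hn; rwa [Nat.cast_one] at h
  have d3 : (arcZ p \ arcZ (p + 1 + (n : ZMod (2 * n)))).card + 1 = n := by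
    have h := delta_add_n (p + 1) p
    rw [d2] at h
    have h' := delta_comm p (p + 1 + (n : ZMod (2 * n)))
    omega
  have d4 : (arcZ (p + 1) \ arcZ (p + (n : ZMod (2 * n)))).card + 1 = n := by
    have h := delta_add_n p (p + 1)
    rw [d1] at h
    have h' := delta_comm (p + 1) (p + (n : ZMod (2 * n)))
    omega
  refine ⟨?_, ?_, ?_, ?_⟩
  · rw [bpot_barc, d1]; exact min_le_left _ _
  · rw [bpot_barc, d2]; exact min_le_left _ _
  · rw [bpot_barc]; exact (min_le_right _ _).trans (by omega)
  · rw [bpot_barc]; exact (min_le_right _ _).trans (by omega)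

end

end Summit.HodgeConjecture.CorCM.Census.QuaternionColumn
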